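import Literature.Probability.RandomPlanarGeometry.SLEBubblesAssembly
import HarnessLib

/-!
# [LSW] p. 5 result 1 — "`P_α` exists if and only if `α ≥ 5/8`" — reduced to its printed leaves

Proof-only file (no new definition, no new named fact) for the named fact
`Literature.Probability.RandomPlanarGeometry.exists_isRestrictionMeasure_iff` of
`RestrictionMeasures`, after

* G. F. Lawler, O. Schramm, W. Werner, *Conformal restriction: the chordal case*, J. Amer. Math.
  Soc. **16** (2003) 917–955, arXiv:math/0209343 (**[LSW]**, arXiv page numbers), p. 5: "Some
  of the main results of this paper can be summarized as follows: 1. The restriction measure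
  `P_α` exists if and only if `α ≥ 5/8`."

In the paper this sentence is the conjunction of two theorems proved by two different theories:

* "only if" is **Cor. 8.6** (p. 37: "For all `α < 5/8`, the two-sided restriction probability
  measure `P_α` does not exist"), via the one-sided measures `P⁺_α` and SLE(8/3, ρ) of §8 — in
  the tree the named fact `not_exists_isRestrictionMeasure_of_lt_five_eighths`
  (`RestrictionMeasuresFiveEighths`), itself reduced (`SLEKappaRho`, `RestrictionLeftFillLaw`) to
  Thm. 8.4 (`SLEKappaRho.isRightRestrictionMeasure_fill`, or unbundled
  `SLEKappaRho.exists_measurable_fill_version` + `SLEKappaRho.measure_fill_disjoint`) and the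
  asymmetry of SLE(8/3, ρ), `ρ < 0` (`SLEKappaRho.one_half_lt_measure_I_notMem_fill`), the rest of
  the proof of Cor. 8.6 (`F^{ℝ₊}_ℍ(P_α) = P⁺_α`, the symmetry bound `≤ 1/2`, positivity of the
  exponent) being theorems of the tree;
* "if" is **Thm. 7.3** (p. 29: "For any `κ ∈ [0, 8/3]`, the law of `Ξ(κ)` is `P_{α_κ}`", with
  `α_κ = (6 − κ)/(2κ)`; "The theorem shows that for all `α > 5/8`, the measure `P_α` exists and
  can be constructed by adding bubbles with appropriate intensity to SLE_κ with `κ = 6/(2α + 1)`")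
  — in the tree the named facts `SLEBubbles.exists_measurable_version` and
  `SLEBubbles.measure_disjoint` (`SLEBubbles`), which are stated for `0 < κ ≤ 8/3` and therefore
  ALSO cover `α = 5/8`: `κ(5/8) = 8/3`, where `λ_{8/3} = 0` (p. 29: "Note that … `λ_{8/3} = 0`"),
  the cloud is empty and `Ξ(8/3) = γ(0, ∞)` is the SLE_{8/3} curve, whose law is `P_{5/8}` by
  Thm. 6.1 (p. 23: "The law of `γ(0, ∞)` is therefore `P_{5/8}`"). To instantiate them one needs a
  Brownian bubble measure (`exists_isBrownianBubbleMeasure`, §7.1) and the Poisson cloud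
  (`SLEBubbles.exists_cloud`, §7.2; from Kingman's theorem `exists_isPoissonCloud` by
  `SLEBubbles.exists_cloud_of_exists_isPoissonCloud`).

Contents (all PROVED):

* `exists_isRestrictionMeasure_iff_iff` — the named fact is EQUIVALENT to the conjunction of
  Cor. 8.6 (`not_exists_isRestrictionMeasure_of_lt_five_eighths`) and "for every `α ≥ 5/8` some
  `P_α` exists" (the "only if" half for an existing `P_α` of exponent `α ≤ 0` being vacuous:
  `IsRestrictionMeasure.exponent_pos`, proved in `RestrictionMeasuresFiveEighths`);
* `sleKappaOfExponent_le` — `κ(α) ≤ 8/3` for `α ≥ 5/8`;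
* `exists_isRestrictionMeasure_of_five_eighths_le_of_bubbles` (and the primed variant fed by
  Kingman's theorem) — **existence of `P_α` for ALL `α ≥ 5/8`** from Thm. 7.3 (version and
  avoidance formula at `κ = κ(α) ∈ (0, 8/3]`), a bubble measure and its cloud: the "if" half;
* `exists_isRestrictionMeasure_iff_of_leaves`, `…_of_bubbles`, `…_of_sleKappaRho`,
  `…_of_bubbles'` — **p. 5 result 1 from the named leaves of the tree**, coarsest to finest; the
  finest takes the same seven named facts as p. 5 result 2 does in
  `IsRestrictionMeasure.eq_five_eighths_of_simple_of_bubbles'` (`SLEBubblesAssembly`), except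
  that the bubble measure is only required to exist (`exists_isBrownianBubbleMeasure`: interior
  points of bubbles play no role in existence).

So `exists_isRestrictionMeasure_iff_holds` is exactly the conjunction of the discharges of
Cor. 8.6 and of Thm. 7.3 (existence form, `κ ∈ (0, 8/3]`); nothing else is missing.
-/

noncomputable section

open Set Filter Topology MeasureTheory
open UpperHalfPlane (upperHalfPlaneSet)
open scoped NNReal ENNReal
open Literature.Probability.Process (preWienerMeasure IsPoissonCloud exists_isPoissonCloud)

namespace Literature.Probability.RandomPlanarGeometry

/-! ### The logical shape of p. 5 result 1 -/

/-- **[LSW] p. 5 result 1 is Cor. 8.6 plus existence above `5/8`.** The named fact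
`exists_isRestrictionMeasure_iff` ("for `α > 0`, `P_α` exists iff `α ≥ 5/8`") is equivalent to
the conjunction of Cor. 8.6 (`not_exists_isRestrictionMeasure_of_lt_five_eighths`: no `P_α` for
`0 < α < 5/8`) and "for every `α ≥ 5/8` there is a `P_α`" (Thm. 7.3 with Thm. 6.1). (`→`: Cor.
8.6 is its "only if" half, `not_exists_isRestrictionMeasure_of_lt_five_eighths_of_iff`; `←`:
`IsRestrictionMeasure.five_eighths_le`, which also uses the proved positivity of the exponent.)
[cite: LawlerSchrammWerner2003Restriction, p. 5 result 1; Cor. 8.6 (p. 37), Thm. 7.3 (p. 29)] -/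
theorem exists_isRestrictionMeasure_iff_iff :
    exists_isRestrictionMeasure_iff ↔
      not_exists_isRestrictionMeasure_of_lt_five_eighths ∧
        ∀ α : ℝ, 5 / 8 ≤ α → ∃ P : Measure RestrictionConfig, IsRestrictionMeasure α P := by
  constructor
  · exact fun h ↦ ⟨not_exists_isRestrictionMeasure_of_lt_five_eighths_of_iff h,
      fun α hα ↦ (h α (by linarith)).2 hα⟩
  · rintro ⟨h86, hex⟩ α _
    exact ⟨fun ⟨P, hP⟩ ↦ hP.five_eighths_le h86, hex α⟩

/-- **p. 5 result 1 from its two halves**: Cor. 8.6 (`h86`) and the existence of `P_α` for every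
`α ≥ 5/8` (`hex`). [cite: LawlerSchrammWerner2003Restriction, p. 5 result 1; Cor. 8.6 (p. 37), Thm. 7.3 (p. 29)] -/
theorem exists_isRestrictionMeasure_iff_of_leaves
    (h86 : not_exists_isRestrictionMeasure_of_lt_five_eighths)
    (hex : ∀ α : ℝ, 5 / 8 ≤ α → ∃ P : Measure RestrictionConfig, IsRestrictionMeasure α P) :
    exists_isRestrictionMeasure_iff :=
  exists_isRestrictionMeasure_iff_iff.2 ⟨h86, hex⟩

/-! ### Existence of `P_α` for every `α ≥ 5/8` ([LSW] Thm. 7.3, `κ = κ(α) ∈ (0, 8/3]`) -/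

/-- `κ(α) = 6/(2α + 1) ≤ 8/3` for `α ≥ 5/8`, with equality at `α = 5/8` (p. 29: "SLE_κ with
`κ = 6/(2α + 1)`"; `κ(5/8) = 8/3`, where `λ_{8/3} = 0`). [cite: LawlerSchrammWerner2003Restriction, §7.2 (p. 29)] -/
theorem sleKappaOfExponent_le {α : ℝ} (hα : 5 / 8 ≤ α) : sleKappaOfExponent α ≤ 8 / 3 := by
  rw [← NNReal.coe_le_coe, coe_sleKappaOfExponent (by linarith)]
  rw [div_le_iff₀ (by linarith)]
  push_cast
  linarith

/-- **Existence of `P_α` for every `α ≥ 5/8`** — the "if" half of [LSW] p. 5 result 1 — from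
Theorem 7.3 (`h₁`: `Ξ(κ)` has an `Ω`-valued measurable version; `h₂`: the avoidance formula
(7.3), both stated for `0 < κ ≤ 8/3`), a Brownian bubble measure (`hμex`, §7.1) and its Poisson
cloud (`hcl`, §7.2): the law of (a version of) `Ξ(κ(α))`, `κ(α) = 6/(2α + 1) ∈ (0, 8/3]`, is a
restriction measure of exponent `α_{κ(α)} = α` (`SLEBubbles.isRestrictionMeasure_map`). At
`α = 5/8` this is `κ = 8/3`, intensity `λ_{8/3} = 0`: `Ξ = γ(0, ∞)` for the SLE_{8/3} curve `γ`,
"The law of `γ(0, ∞)` is therefore `P_{5/8}`" (Thm. 6.1, p. 23).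
[cite: LawlerSchrammWerner2003Restriction, Thm. 7.3 (p. 29) with Thm. 6.1 (p. 23) and p. 5 result 1] -/
theorem exists_isRestrictionMeasure_of_five_eighths_le_of_bubbles
    (hμex : exists_isBrownianBubbleMeasure) (hcl : SLEBubbles.exists_cloud)
    (h₁ : SLEBubbles.exists_measurable_version) (h₂ : SLEBubbles.measure_disjoint)
    {α : ℝ} (hα : 5 / 8 ≤ α) :
    ∃ P : Measure RestrictionConfig, IsRestrictionMeasure α P := by
  obtain ⟨μ, hμ⟩ := hμex
  have hα0 : 0 ≤ α := by linarith
  obtain ⟨Ω', _, P', X, hX⟩ := hcl hμ (sleKappaOfExponent α)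
  obtain ⟨Kc, -, -, hP⟩ := SLEBubbles.isRestrictionMeasure_map h₁ h₂ (sleKappaOfExponent_pos hα0)
    (sleKappaOfExponent_le hα) hμ hX
  rw [sleBubbleExponent_sleKappaOfExponent hα0] at hP
  exact ⟨_, hP⟩

/-- The same with the cloud supplied by **Kingman's existence theorem**
(`Literature.Probability.Process.exists_isPoissonCloud`, through
`SLEBubbles.exists_cloud_of_exists_isPoissonCloud`) and the bubble measure by the sharper leaf of
`SLEBubblesAssembly` (`exists_isBrownianBubbleMeasure_ae_interior_nonempty`, of which only the
existence clause is used). [cite: LawlerSchrammWerner2003Restriction, Thm. 7.3 (p. 29) with §7.1–7.2 (pp. 27–28)] -/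
theorem exists_isRestrictionMeasure_of_five_eighths_le_of_bubbles'
    (hμex : exists_isBrownianBubbleMeasure_ae_interior_nonempty) (hK : exists_isPoissonCloud.{0})
    (h₁ : SLEBubbles.exists_measurable_version) (h₂ : SLEBubbles.measure_disjoint)
    {α : ℝ} (hα : 5 / 8 ≤ α) :
    ∃ P : Measure RestrictionConfig, IsRestrictionMeasure α P := by
  obtain ⟨μ, hμ, -⟩ := hμex
  exact exists_isRestrictionMeasure_of_five_eighths_le_of_bubbles ⟨μ, hμ⟩
    (SLEBubbles.exists_cloud_of_exists_isPoissonCloud hK) h₁ h₂ hα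

/-! ### p. 5 result 1 from the named leaves of the tree -/

/-- **[LSW] p. 5 result 1 from Cor. 8.6 and Thm. 7.3**: the named fact
`exists_isRestrictionMeasure_iff` from Cor. 8.6 as vendored (`h86`) and the existence inputs of
Thm. 7.3 (`hμex`, `hcl`, `h₁`, `h₂`). [cite: LawlerSchrammWerner2003Restriction, p. 5 result 1; Cor. 8.6 (p. 37), Thm. 7.3 (p. 29)] -/
theorem exists_isRestrictionMeasure_iff_of_bubbles
    (hμex : exists_isBrownianBubbleMeasure) (hcl : SLEBubbles.exists_cloud)
    (h₁ : SLEBubbles.exists_measurable_version) (h₂ : SLEBubbles.measure_disjoint)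
    (h86 : not_exists_isRestrictionMeasure_of_lt_five_eighths) : exists_isRestrictionMeasure_iff :=
  exists_isRestrictionMeasure_iff_of_leaves h86 fun _ hα ↦
    exists_isRestrictionMeasure_of_five_eighths_le_of_bubbles hμex hcl h₁ h₂ hα

/-- **[LSW] p. 5 result 1 from Thm. 7.3, Thm. 8.4 and the asymmetry of SLE(8/3, ρ)**: with Cor.
8.6 supplied by its proof from Thm. 8.4 in law form (`g84`,
`SLEKappaRho.isRightRestrictionMeasure_fill`) and the first two sentences of the proof of Cor. 8.6
(`g86`, `SLEKappaRho.one_half_lt_measure_I_notMem_fill`), through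
`not_exists_isRestrictionMeasure_of_lt_five_eighths_of_sleKappaRho`.
[cite: LawlerSchrammWerner2003Restriction, p. 5 result 1; Thm. 7.3 (p. 29), Thm. 8.4 and Cor. 8.6 (pp. 37–38)] -/
theorem exists_isRestrictionMeasure_iff_of_sleKappaRho
    (hμex : exists_isBrownianBubbleMeasure) (hcl : SLEBubbles.exists_cloud)
    (h₁ : SLEBubbles.exists_measurable_version) (h₂ : SLEBubbles.measure_disjoint)
    (g84 : SLEKappaRho.isRightRestrictionMeasure_fill)
    (g86 : SLEKappaRho.one_half_lt_measure_I_notMem_fill) : exists_isRestrictionMeasure_iff :=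
  exists_isRestrictionMeasure_iff_of_bubbles hμex hcl h₁ h₂
    (not_exists_isRestrictionMeasure_of_lt_five_eighths_of_sleKappaRho g84 g86)

/-- **[LSW] p. 5 result 1 from seven named facts** — the same seven as p. 5 result 2 in
`IsRestrictionMeasure.eq_five_eighths_of_simple_of_bubbles'` (`SLEBubblesAssembly`), with the
bubble measure only required to exist: §7.1's bubble measure (`hμex`,
`exists_isBrownianBubbleMeasure`), Kingman's existence theorem (`hK`), Thm. 7.3 (`h₁`, `h₂`),
and from §8 the `Ω₊`-valued version of `F^{ℝ₊}_ℍ(cl K_∞)` for SLE(8/3, ρ) (`g₁`), Thm. 8.4's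
avoidance formula (`g₂`) and the asymmetry of SLE(8/3, ρ), `ρ < 0` (`g₃`).
[cite: LawlerSchrammWerner2003Restriction, p. 5 result 1; Thm. 7.3 (p. 29), Thm. 8.4 and Cor. 8.6 (pp. 37–38)] -/
theorem exists_isRestrictionMeasure_iff_of_bubbles'
    (hμex : exists_isBrownianBubbleMeasure) (hK : exists_isPoissonCloud.{0})
    (h₁ : SLEBubbles.exists_measurable_version) (h₂ : SLEBubbles.measure_disjoint)
    (g₁ : SLEKappaRho.exists_measurable_fill_version) (g₂ : SLEKappaRho.measure_fill_disjoint)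
    (g₃ : SLEKappaRho.one_half_lt_measure_I_notMem_fill) : exists_isRestrictionMeasure_iff :=
  exists_isRestrictionMeasure_iff_of_sleKappaRho hμex (SLEBubbles.exists_cloud_of_exists_isPoissonCloud hK)
    h₁ h₂ (SLEKappaRho.isRightRestrictionMeasure_fill_of g₁ g₂) g₃

/-- Conversely, p. 5 result 1 yields `P_{5/8}` and `P_1` (the laws of the SLE_{8/3} curve, Thm.
6.1, and of the filled Brownian excursion, Thm. 4.1 / §4) — recorded as the two instances the
paper names. [cite: LawlerSchrammWerner2003Restriction, p. 5 result 1 with Thm. 6.1 (p. 23) and §4] -/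
theorem exists_isRestrictionMeasure_five_eighths_and_one (h : exists_isRestrictionMeasure_iff) :
    (∃ P : Measure RestrictionConfig, IsRestrictionMeasure (5 / 8) P) ∧
      ∃ P : Measure RestrictionConfig, IsRestrictionMeasure 1 P :=
  ⟨(h _ (by norm_num)).2 le_rfl, (h _ one_pos).2 (by norm_num)⟩

end Literature.Probability.RandomPlanarGeometry

end
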